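import Summits.MatrixMultiplication.MatrixMultiplication.Theorems.ObstructionDescentDegreeWindow

/- `set_option linter.dupNamespace false` as in the sibling kernel files (namespace `…Theorems.<FileStem>`). -/
set_option linter.dupNamespace false

/-!
# Obstruction descent — the blind window as a function of the GAP-ONE THRESHOLD (interface for sharper thresholds)

Route `route-MatrixMultiplication-ObstructionDescent`, leaf `E = NoPolyDegreeObstruction` (item 30889), degree axis.  The certified window
`D ≤ 2m − 3N + 4` of `ObstructionDescentDegreeWindow` is `2m − d₀ + 2` with the gap-one threshold `d₀ = 3N − 2` of
`gapOneEquationsVanish_holds` (Casimir count).  The conjectured truth is `d₀(N) = N + 2` (NODE-g23 §2, conjecture G1: `N = 2, 3` exact;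
`N = 4` hinges on `I_6(σ_5((ℂ^4)^{⊗3})) = 0`), which would give the window `D ≤ 2m − N`.

This file isolates the dependence: for ANY threshold `d₀` from which gap-one emptiness `I_d(σ_{d−1}((ℂ^N)^{⊗3})) = 0` (`d ≥ d₀`) holds,
* `rv_eq_zero_of_threshold`: an equation of `σ_m((ℂ^N)^{⊗3})` of degree `≤ 2m − d₀ + 2` is zero (cone lemma + `gapPropagation_holds` +
  format-degree blindness — the proof of `ObstructionDescentDoubleDegree.rv_eq_zero_of_degree_le` with the threshold as a parameter);
* `mem_hull_of_threshold` / `truncRank_le_of_threshold`: every `t ∈ (ℂ^N)^{⊗3}` lies in `Hull_D(σ_m)` for `D + d₀ ≤ 2m + 2`;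
* `orbit_blind_of_threshold`: the `DoubleDegreeBlind` conclusion (vanishing at `(A⊗B⊗C)·pad_m(t)` of every equation of `GL_m³·⟨m⟩` of degree
  `≤ 2m − d₀ + 2`) from the threshold hypothesis alone.
So a future proof of gap-one emptiness from a smaller `d₀` (e.g. G1) upgrades rung R3 by instantiating these three theorems; nothing else in the
chain needs to change.  [this cell, NODE-g23 §2–§4; cites: LandsbergManivel2004 Prop. 3.3, LandsbergGCT2017 §8.3.2]
-/

namespace Summit.MatrixMultiplication.MatrixMultiplication.Theorems.ObstructionDescentThresholdWindow

open MvPolynomial Finset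
open ObstructionDescentPolarForm ObstructionDescentGapPropagation ObstructionDescentDoubleDegree
open ObstructionDescentTorusLaws (RV mem_RV eq_zero_of_totalDegree_le)
open ObstructionDescentCountingEquations (totalDegree_bind₁_le_mul)
open ObstructionDescentHullCalculus (hull mem_hull truncRank mem_hull_iff_truncRank_le actForm totalDegree_actForm_le
  aeval_bind₁_actForm bind₁_actForm_mem_RV)
open ObstructionCalculus (Idx padTensor)
open Literature.Computability.AlgebraicComplexity (tensorRank actTensor unitTensor)

variable {N m D : ℕ}

/-- LOW DEGREE ⟹ ZERO, parametrised by the gap-one threshold `d₀`: if `I_d(σ_{d−1}((ℂ^N)^{⊗3})) = 0` for all `d ≥ d₀`, then every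
equation of `σ_m((ℂ^N)^{⊗3})` of total degree `≤ 2m − d₀ + 2` is zero. [this cell, NODE-g23 §3–§4] -/
theorem rv_eq_zero_of_threshold (d₀ : ℕ)
    (hGap : ∀ d : ℕ, d₀ ≤ d → ∀ f : MvPolynomial (Fin N × Fin N × Fin N) ℂ, f.IsHomogeneous d →
      (∀ t : Fin N → Fin N → Fin N → ℂ, tensorRank t < d →
        MvPolynomial.aeval (fun p : Fin N × Fin N × Fin N => t p.1 p.2.1 p.2.2) f = 0) → f = 0)
    (g : MvPolynomial (Pt N) ℂ) (hg : g ∈ RV (Fin N) (Fin N) (Fin N) m) (hdeg : g.totalDegree + d₀ ≤ 2 * m + 2) : g = 0 := by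
  classical
  have hhigh : ∀ k, m < k → homogeneousComponent k g = 0 := by
    intro k hk
    by_cases hkD : g.totalDegree < k
    · exact homogeneousComponent_eq_zero (n := k) (φ := g) hkD
    · have hkD' : k ≤ g.totalDegree := not_lt.mp hkD
      exact gapPropagation_holds N d₀ hGap m k hk (by omega) _ (homogeneousComponent_isHomogeneous k g)
        fun t ht => mem_RV.1 (homogeneousComponent_mem_RV g hg k) t ht
  have hsum : g = ∑ i ∈ (range (g.totalDegree + 1)).filter (fun i => i ≤ m), homogeneousComponent i g := by
    conv_lhs => rw [← sum_homogeneousComponent g]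
    rw [← Finset.sum_filter_add_sum_filter_not (range (g.totalDegree + 1)) (fun i => i ≤ m)]
    have hz : ∑ i ∈ (range (g.totalDegree + 1)).filter (fun i => ¬ i ≤ m), homogeneousComponent i g = 0 :=
      Finset.sum_eq_zero fun i hi => hhigh i (not_le.mp (Finset.mem_filter.mp hi).2)
    rw [hz, add_zero]
  have hD : g.totalDegree ≤ m := by
    rw [hsum]
    refine (totalDegree_finsetSum _ _).trans (Finset.sup_le fun i hi => ?_)
    exact (homogeneousComponent_isHomogeneous i g).totalDegree_le.trans (Finset.mem_filter.mp hi).2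
  exact eq_zero_of_totalDegree_le hg hD

/-- WINDOW from a threshold: every `t ∈ (ℂ^N)^{⊗3}` lies in `Hull_D(σ_m)` whenever `D + d₀ ≤ 2m + 2`. [this cell] -/
theorem mem_hull_of_threshold (d₀ : ℕ)
    (hGap : ∀ d : ℕ, d₀ ≤ d → ∀ f : MvPolynomial (Fin N × Fin N × Fin N) ℂ, f.IsHomogeneous d →
      (∀ t : Fin N → Fin N → Fin N → ℂ, tensorRank t < d →
        MvPolynomial.aeval (fun p : Fin N × Fin N × Fin N => t p.1 p.2.1 p.2.2) f = 0) → f = 0)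
    (hD : D + d₀ ≤ 2 * m + 2) (t : Fin N → Fin N → Fin N → ℂ) : t ∈ hull (Fin N) (Fin N) (Fin N) m D := by
  rw [mem_hull]
  intro f hf hRV
  rw [rv_eq_zero_of_threshold d₀ hGap f hRV (by omega), map_zero]

/-- `R_D(t) ≤ m` for every `t ∈ (ℂ^N)^{⊗3}` whenever `D + d₀ ≤ 2m + 2`, `d₀` a gap-one threshold. [this cell] -/
theorem truncRank_le_of_threshold (d₀ : ℕ)
    (hGap : ∀ d : ℕ, d₀ ≤ d → ∀ f : MvPolynomial (Fin N × Fin N × Fin N) ℂ, f.IsHomogeneous d →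
      (∀ t : Fin N → Fin N → Fin N → ℂ, tensorRank t < d →
        MvPolynomial.aeval (fun p : Fin N × Fin N × Fin N => t p.1 p.2.1 p.2.2) f = 0) → f = 0)
    (hD : D + d₀ ≤ 2 * m + 2) (t : Fin N → Fin N → Fin N → ℂ) : truncRank D t ≤ m :=
  mem_hull_iff_truncRank_le.1 (mem_hull_of_threshold d₀ hGap hD t)

/-- ORBIT BLINDNESS from a threshold: an equation of `GL_m³·⟨m⟩` of degree `≤ 2m − d₀ + 2` vanishes at `(A⊗B⊗C)·pad_m(t)` for every corner
tensor `t ∈ (ℂ^N)^{⊗3}` (`N ≤ m`) and all `A, B, C` — the `DoubleDegreeBlind` conclusion with the threshold as a parameter. [this cell] -/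
theorem orbit_blind_of_threshold (d₀ : ℕ)
    (hGap : ∀ d : ℕ, d₀ ≤ d → ∀ f : MvPolynomial (Fin N × Fin N × Fin N) ℂ, f.IsHomogeneous d →
      (∀ t : Fin N → Fin N → Fin N → ℂ, tensorRank t < d →
        MvPolynomial.aeval (fun p : Fin N × Fin N × Fin N => t p.1 p.2.1 p.2.2) f = 0) → f = 0)
    (h : N ≤ m) (f : MvPolynomial (Idx m) ℂ) (hdeg : f.totalDegree + d₀ ≤ 2 * m + 2)
    (hvan : ∀ A B C : Matrix (Fin m) (Fin m) ℂ, A.det ≠ 0 → B.det ≠ 0 → C.det ≠ 0 →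
      MvPolynomial.aeval (fun p : Idx m => actTensor A B C (unitTensor ℂ m) p.1 p.2.1 p.2.2) f = 0)
    (t : Fin N → Fin N → Fin N → ℂ) (A B C : Matrix (Fin m) (Fin m) ℂ) :
    MvPolynomial.aeval (fun q : Idx m => actTensor A B C (padTensor (Fin.castLE h) t) q.1 q.2.1 q.2.2) f = 0 := by
  classical
  have hRV : f ∈ RV (Fin m) (Fin m) (Fin m) m := mem_RV_of_orbit f hvan
  have hgRV : MvPolynomial.bind₁ (actForm (padMat (Fin.castLE h)) (padMat (Fin.castLE h)) (padMat (Fin.castLE h)))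
      (MvPolynomial.bind₁ (actForm A B C) f) ∈ RV (Fin N) (Fin N) (Fin N) m :=
    bind₁_actForm_mem_RV _ _ _ (bind₁_actForm_mem_RV A B C hRV)
  have hgdeg : (MvPolynomial.bind₁ (actForm (padMat (Fin.castLE h)) (padMat (Fin.castLE h)) (padMat (Fin.castLE h)))
      (MvPolynomial.bind₁ (actForm A B C) f)).totalDegree ≤ f.totalDegree := by
    refine ((totalDegree_bind₁_le_mul _ 1 (totalDegree_actForm_le _ _ _) _).trans_eq (one_mul _)).trans ?_
    exact (totalDegree_bind₁_le_mul _ 1 (totalDegree_actForm_le A B C) f).trans_eq (one_mul _)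
  have hg0 := rv_eq_zero_of_threshold d₀ hGap _ hgRV (by omega)
  have hev : MvPolynomial.aeval (fun p : Pt N => t p.1 p.2.1 p.2.2)
      (MvPolynomial.bind₁ (actForm (padMat (Fin.castLE h)) (padMat (Fin.castLE h)) (padMat (Fin.castLE h)))
        (MvPolynomial.bind₁ (actForm A B C) f)) =
      MvPolynomial.aeval (fun q : Idx m => actTensor A B C (padTensor (Fin.castLE h) t) q.1 q.2.1 q.2.2) f := by
    rw [aeval_bind₁_actForm, aeval_bind₁_actForm, ← padTensor_eq_actTensor]
  rw [← hev, hg0, map_zero]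

/- Sanity link (not restated as a theorem — it would duplicate `ObstructionDescentDegreeWindow.mem_hull_of_window`): the landed
threshold `d₀ = 3N − 2` is an admissible instance, `mem_hull_of_threshold (3 * N - 2) (fun d hd f hf hv =>
ObstructionDescentGapOne.gapOneEquationsVanish_holds N d hN (by omega) f hf hv)`, recovering the window `D + 3N ≤ 2m + 4`. -/

end Summit.MatrixMultiplication.MatrixMultiplication.Theorems.ObstructionDescentThresholdWindow
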